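import Summits.QuantumFields.BalabanUV.T4Continuum.Support.T4TrajectoryDensityAssemblyModSliceWin
import Summits.QuantumFields.BalabanUV.T4Continuum.Spine.NE1p.DressedTransportAssembledMod
import Summits.QuantumFields.BalabanUV.T4Continuum.Spine.NE1p.DressedRootSliceWin
import Summits.QuantumFields.BalabanUV.T4Continuum.Spine.NE1p.DressedWindowScheduleModWin

/-!
# T⁴ programme, spine estimate NE1′ (node O3b/H2) — END-F′-mod-swin: THE ASSEMBLED TRANSPORT LEAF WITH PER-STEP CHART AND SLICE
# WINDOWS, and its window schedule with a CUTOFF-FREE birth window (located findings F-ne1pleaf08-1 ∕ F-ne1pleaf04-1 closed at the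
# typed level; swarm row «S1-win» concluded)

Cell `pub-balaban`, sub-cell `t4`, BINDER-OWNERS row NE1′, NE1′ formalisation swarm `b2b-balaban-t4-ne1p-formalise-*`, leaf prover
04; tree target `Summits/QuantumFields/BalabanUV/T4Continuum/Spine/NE1p/`; ADDITIVE — imports `Support/T4TrajectoryDensityAssemblyModSliceWin`
(this seat: `pertSlice_under_history_mod_swin`), leaf-08's `Spine/NE1p/DressedTransportAssembledMod` (p213245: `budgetShare_le_mod`),
`Spine/NE1p/DressedRootSliceWin` (END-F-swin) and `Spine/NE1p/DressedWindowScheduleModWin` (the schedule, p213785) ONLY; END-F ∕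
END-F′ ∕ END-F-win ∕ END-F′-mod(-win) untouched.

WHAT.  §1 **`transportLeaf_assembled_mod_swin`** = leaf-08's END-F′-mod-win (`DressedTransportAssembledModWin`, the modulus route:
NO radius floor, `‖c b k‖ ≤ m`) with every SLICE per step: births on `wk b k′ k′`, the action exponent on `wk b k′ (k+1)`, the
cross-family complex margin `hN2cx` and fresh pairs `hpairx` asked only for directions `latN pd ≤ wk b k′ (k+1)`, the cross-family
window order `hwkx`, no `hw`; proof = leaf-08's: `budgetShare_le_mod` ⟹ the dressed gate gives the function-level budget;
`pertSlice_under_history_mod_swin` ⟹ `hP` on the window `wk b k′ (k+1)`, `.mono` to the dressed budget's size; END-F-swin BY NAME.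
Conclusion: VERBATIM the field type of `BookingLeaves.htr` with `C = 4c_δ/r`, `ρ i = ψ·α i`.  §2 **`transportLeaf_assembled_mod_swin_of_schedule`**:
its FOURTEEN geometric ∕ radius ∕ window binders (`hD`, `hϱ`, `hrs_birth`, `hrs_step`, `hrs_dec`, `hmargin`, `hN1`, `hN2`, `hN1x`,
`hN2cx`, `hwkx`, `hdiam`, `hθ`, `hθwk`, `hwk`, `hwk_anti` — sixteen counting the window bounds) DISCHARGED from ONE
`WindowScheduleModWin r w` (`𝒦 := bondBall d (ρw k)`, `D := bondBall d (σ k)`, `θ := 2σ k`, `ϱ := ϱc k`, `ϱ₁ := ϱ₁ k`,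
`wk := wc k`, `rs := sliceRadius W`), given `z₁ b k ∈ D b k`.  With `WindowScheduleModWin.geometric` every window, radius and
chart window is geometric and the birth window is the CUTOFF-FREE `ρ∞ + ((1+2q)σ₀ + ϱ₀)/(1−q)` (`geometric_birthWindow`), the (w4)
profile the constant `e³(1 + 4·2σ₀/(ϱ₀q))` (`geometric_hdom`): the typed window bookkeeping of the ASSEMBLED leaf no longer forces a
cutoff-dependent constant — what remains displayed is estimate ∕ dictionary content only ((w1) `hsl`, H2 `hFn`/`h𝒢`/`hQ`/`hSg`/`hs1`/
`hAsz_*`, (w2-act) `hB`/`hE`, `hDμ`, (w4) `hdom`, (I4′) `hpairx`/`hδf`/`hδfwk`/`hdefwk`/`hrate`, `hcm : ‖c b k‖ ≤ m`, `hcδ`/`hψ`,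
attainment `hlin`, invariance, measurability) — whose joint cutoff-free validity on Bałaban's densities IS the wall.

HONEST FRAMING.  Rung (B)+1 bookkeeping on ONE finite four-torus of fixed physical size — NOT infinite volume, NOT a mass gap, NOT
OS on ℝ⁴, NOT the Clay problem, NOT summit progress.  NE1′ is NOT PRINTED and NOT PROVED; this file reads «L-T ⇐ the displayed
estimate binders + a schedule with cutoff-free birth window», never «NE1′ proved».  (w2-act) `hB`/`hE` are the printed TYPE
[Balaban1989LargeFieldII] (1.65) p. 375, (1.71)–(1.75) pp. 379–380, asserted for Bałaban's densities NOWHERE; (I4′)'s rate `ψ` is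
the cell's READING (CITED-FACTS-T4 v1 §2/§4); the schedule is a BINDER's witness in the ONE-FRAME bond-ball model — nothing of
Bałaban's windows asserted ((w3)⁺, OWNER-ANSWERS-g23 §F/§G untouched).  [folklore] kernel glue, 0 sorry, 0 citations used as facts,
no `def … : Prop`.  Spine PROVED 0∕9 unchanged.  HONEST DEPENDENCY: continuum YM on T⁴ ⇐ BetaPertH ∧ nine spine estimates (0/9
proved); BetaPertH ⇐ (D1) ∧ (D4) ∧ CAP+tail; G-an2-4 gates asym, D1 and NE2/3/4.
-/

noncomputable section

namespace Summit.QuantumFields.BalabanUV.T4Continuum.NE1p.DressedTransportAssembledModSliceWin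

open MeasureTheory Set Metric Filter Finset
open scoped BigOperators
open Literature.MathematicalPhysics.QuantumFieldTheory.Balaban1983to89
open Literature.MathematicalPhysics.QuantumFieldTheory.Balaban1983to89.T4TermFormat
open Literature.MathematicalPhysics.QuantumFieldTheory.Balaban1983to89.T4TermFormat.Booking
open Literature.MathematicalPhysics.QuantumFieldTheory.Balaban1983to89.T4GatedBooking
open Literature.MathematicalPhysics.QuantumFieldTheory.Balaban1983to89.T4TrajectoryComparison
open Literature.MathematicalPhysics.QuantumFieldTheory.Balaban1983to89.T4TrajectoryModulus
open Summit.QuantumFields.BalabanUV.T4Continuum.T4TrajectoryDensityDressed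
open Summit.QuantumFields.BalabanUV.T4Continuum.NE1p.DressedRoot
open Summit.QuantumFields.BalabanUV.T4Continuum.NE1p.DressedTransportAssembledMod
open Summit.QuantumFields.BalabanUV.T4Continuum.NE1p.DressedRootSliceWin
open Summit.QuantumFields.BalabanUV.T4Continuum.NE1p.DressedWindowScheduleWin
open Summit.QuantumFields.BalabanUV.T4Continuum.NE1p.DressedWindowScheduleModWin
open T4BirthChartTransport (GaugeInvariant BirthSlice RelGauge)
open T4BlockTransport (Fld NDir latMove latN latMove_zero)
open T4TrajectoryDensity

/-! ## §1 END-F′-mod-swin: the assembled transport leaf, modulus route, per-step chart and slice windows [bookkeeping] -/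

section FunctionLevel

variable {B : T4TermFormat.Booking} {T : Trajectory B}
variable {R : Type*} [NormedRing R] [NormedAlgebra ℂ R] [MeasurableSpace R] {d : ℕ}

/-- **END-F′-mod-swin — THE TRANSPORT LEAF `htr` WITH `hP` ASSEMBLED UNDER THE HISTORY (modulus route, no radius floor) AND EVERY
SLICE ON THE PER-STEP WINDOW** [bookkeeping]: leaf-08's END-F′-mod-win with births on `wk b k′ k′`, the action exponent on
`wk b k′ (k+1)`, `hN2cx`/`hpairx` guarded at `latN pd ≤ wk b k′ (k+1)`, `hwkx : wk b k′ (k+1) ≤ wk p.1 p.2 k` for the live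
generations of the met component, and no `hw`.  Inside: (a) `budgetShare_le_mod` — the function-level fresh budget
`s1 b k = ‖c b k‖·Σ_p (4/r·stepProd α p.2 k·gen p)·δf b k p` is below the dressed gate's share `m·Σ_f envVar (4c_δ/r) (ψα) f k`
outright from `‖c b k‖ ≤ m`, `0 ≤ δf ≤ c_δψ^{k−k″}`; (b) hence the dressed gate of scale `k` IS the function-level budget;
(c) `pertSlice_under_history_mod_swin` ⟹ `hP` on `wk b k′ (k+1)`; (d) END-F-swin BY NAME.  Conclusion: LITERALLY the field
`htr` of `BookingLeaves` with `C = 4c_δ/r`, `ρ i = ψ·α i`.  Nothing of Bałaban's densities is asserted. [folklore] -/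
theorem transportLeaf_assembled_mod_swin {Fn : B.Birth → ℕ → ℕ → Fld d R → ℂ}
    {rel : B.Birth → ℕ → ℕ → Fld d R → Fld d R → Prop} {𝒦 : B.Birth → ℕ → ℕ → Set (Fld d R)}
    {ref : B.Birth → ℕ → Fld d R → Fld d R} {base : B.Birth → ℕ → Fld d R → ℝ}
    {𝒜 𝒬 : B.Birth → ℕ → Fld d R → Fld d R → ℂ} {q : B.Birth → ℕ → Fld d R → ℂ}
    {μ : B.Birth → ℕ → Measure (Fld d R)} {z₀ z₁ : B.Birth → ℕ → Fld d R} {D : B.Birth → ℕ → Set (Fld d R)}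
    {defect : B.Birth → ℕ → ℕ → ℝ} {cδ ψ w r m : ℝ} {s θ s1 ϱ₁ : B.Birth → ℕ → ℝ} {α : ℕ → ℝ}
    {ϱ rs Asz wk : B.Birth → ℕ → ℕ → ℝ} {S : ℕ → B.Birth → Finset B.Birth}
    {Sg : ℕ → B.Birth → Finset (B.Birth × ℕ)} {c : B.Birth → ℕ → ℂ} {δf : B.Birth → ℕ → B.Birth × ℕ → ℝ}
    (hα : ∀ i, 0 ≤ α i) (hr : 0 < r) (hcδ : 0 ≤ cδ) (hψ : 0 ≤ ψ)
    (hsl : ∀ (b : B.Birth) (k' : ℕ), B.birthScale b ≤ k' → k' ≤ B.K →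
      RanBelow (budgetGate T s m S (4 * cδ / r) (fun i => ψ * α i)) k' →
      BirthSlice (Fn b k' k') latMove latN (𝒦 b k' k') (wk b k' k') r (T.gen b k'))
    (hFn : ∀ (b : B.Birth) (k' k : ℕ), B.birthScale b ≤ k' → k' ≤ k → k + 1 ≤ B.K →
      RanBelow (budgetGate T s m S (4 * cδ / r) (fun i => ψ * α i)) (k + 1) →
      ∀ U, Fn b k' (k + 1) U =
        wOp (expWeight (base b k) (𝒜 b k + 𝒬 b k)) (μ b k) (z₀ b k) U (fun z => Fn b k' k (U + z)))
    (h𝒢 : ∀ (b : B.Birth) (k' k : ℕ), B.birthScale b ≤ k' → k' ≤ k → k + 1 ≤ B.K →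
      RanBelow (budgetGate T s m S (4 * cδ / r) (fun i => ψ * α i)) (k + 1) →
      ∀ U, (fun z => Fn b k' k (U + z)) ∈ BddClass ℂ (μ b k))
    (hD : ∀ b k, (D b k).Nonempty) (hϱ : ∀ b k' k, 0 < ϱ b k' k)
    (hB : ∀ (b : B.Birth) (k' k : ℕ), B.birthScale b ≤ k' → k' ≤ k → k + 1 ≤ B.K →
      RanBelow (budgetGate T s m S (4 * cδ / r) (fun i => ψ * α i)) (k + 1) →
      RealBaseAt (ref b k) (base b k) (𝒜 b k) (μ b k) (𝒦 b k' (k + 1)))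
    (hE : ∀ (b : B.Birth) (k' k : ℕ), B.birthScale b ≤ k' → k' ≤ k → k + 1 ≤ B.K →
      RanBelow (budgetGate T s m S (4 * cδ / r) (fun i => ψ * α i)) (k + 1) →
      ExponentSliceAt (ref b k) (𝒜 b k) (μ b k) latMove latN (𝒦 b k' (k + 1)) (wk b k' (k + 1)) (ϱ b k' k) (s b k))
    (hQ : ∀ b k, (fun U z => 𝒬 b k U z - q b k U) =
      fun U z => c b k * ∑ p ∈ Sg k b, (Fn p.1 p.2 k (U + z) - Fn p.1 p.2 k (U + z₁ b k)))
    (hSg : ∀ k b, ∀ p ∈ Sg k b, p.1 ∈ S k b ∧ B.birthScale p.1 ≤ p.2 ∧ p.2 ≤ k)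
    (hs1 : ∀ b k, s1 b k = ‖c b k‖ * ∑ p ∈ Sg k b, (4 / r * stepProd α p.2 k * T.gen p.1 p.2) * δf b k p)
    (hAsz_birth : ∀ f k'', Asz f k'' k'' = T.gen f k'') (hrs_birth : ∀ f k'', rs f k'' k'' = r)
    (hAsz_step : ∀ f k'' k, B.birthScale f ≤ k'' → k'' ≤ k →
      Asz f k'' (k + 1) = Real.exp (3 * (s f k + s1 f k)) * Asz f k'' k)
    (hrs_step : ∀ f k'' k, B.birthScale f ≤ k'' → k'' ≤ k → rs f k'' (k + 1) = ϱ f k'' k)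
    (hrs_dec : ∀ f k'' k, B.birthScale f ≤ k'' → k'' ≤ k → ϱ f k'' k < rs f k'' k)
    (hmargin : ∀ (b : B.Birth) (k' k : ℕ), B.birthScale b ≤ k' → k' ≤ k →
      ϱ b k' k < ϱ₁ b k ∧ 0 < ϱ₁ b k ∧ ∀ p ∈ Sg k b, ϱ₁ b k ≤ rs p.1 p.2 k)
    (hcm : ∀ b k, ‖c b k‖ ≤ m)
    (hδf : ∀ b k, ∀ p ∈ Sg k b, 0 ≤ δf b k p ∧ δf b k p ≤ cδ * ψ ^ (k - p.2))
    (hδfwk : ∀ b k, ∀ p ∈ Sg k b, δf b k p ≤ wk p.1 p.2 k)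
    (hwkx : ∀ (b : B.Birth) (k' k : ℕ), B.birthScale b ≤ k' → k' ≤ k → ∀ p ∈ Sg k b, wk b k' (k + 1) ≤ wk p.1 p.2 k)
    (hDμ : ∀ b k, ∀ᵐ z ∂μ b k, z ∈ D b k)
    (hN1 : ∀ (b : B.Birth) (k' k : ℕ), B.birthScale b ≤ k' → k' ≤ k → k + 1 ≤ B.K →
      ∀ z ∈ D b k, ∀ U ∈ 𝒦 b k' (k + 1), U + z ∈ 𝒦 b k' k)
    (hN2 : ∀ (b : B.Birth) (k' k : ℕ), B.birthScale b ≤ k' → k' ≤ k → k + 1 ≤ B.K →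
      ∀ U₀ ∈ 𝒦 b k' (k + 1), ∀ p : NDir d R, latN p ≤ wk b k' (k + 1) → ∀ z' ∈ D b k,
        latMove U₀ p 1 + z' ∈ 𝒦 b k' k)
    (hN1x : ∀ (b : B.Birth) (k' k : ℕ), B.birthScale b ≤ k' → k' ≤ k →
      ∀ p ∈ Sg k b, ∀ z ∈ D b k, ∀ U ∈ 𝒦 b k' (k + 1), U + z ∈ 𝒦 p.1 p.2 k)
    (hN2cx : ∀ (b : B.Birth) (k' k : ℕ), B.birthScale b ≤ k' → k' ≤ k →
      ∀ p ∈ Sg k b, ∀ U₀ ∈ 𝒦 b k' (k + 1), ∀ pd : NDir d R, 0 < latN pd → latN pd ≤ wk b k' (k + 1) →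
        ∀ t ∈ tube (ϱ₁ b k / latN pd), latMove U₀ pd t + z₁ b k ∈ 𝒦 p.1 p.2 k)
    (hpairx : ∀ (b : B.Birth) (k' k : ℕ), B.birthScale b ≤ k' → k' ≤ k →
      ∀ p ∈ Sg k b, ∀ U₀ ∈ 𝒦 b k' (k + 1), ∀ pd : NDir d R, 0 < latN pd → latN pd ≤ wk b k' (k + 1) →
        ∀ᵐ z ∂μ b k, ∀ t ∈ tube (ϱ₁ b k / latN pd),
          RelGauge (rel p.1 p.2 k) latMove latN (latMove U₀ pd t + z₁ b k) (latMove U₀ pd t + z) (δf b k p))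
    (hdiam : ∀ b k, ∀ z ∈ D b k, ∀ z' ∈ D b k, ∀ x ν, ‖z x ν - z' x ν‖ ≤ θ b k)
    (hθ : ∀ b k, 0 < θ b k ∧ θ b k ≤ w) (hθwk : ∀ b k' k, θ b k ≤ wk b k' k)
    (hwk : ∀ b k' k, wk b k' k ≤ w) (hwk_anti : ∀ b k' k, wk b k' (k + 1) ≤ wk b k' k)
    (hdom : ∀ (b : B.Birth) (k' k : ℕ), B.birthScale b ≤ k' → k' ≤ k → k + 1 ≤ B.K →
      Real.exp 3 * (1 + 4 * θ b k / ϱ b k' k) ≤ α k)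
    (hinv : ∀ b k' k, GaugeInvariant (rel b k' k) (Fn b k' k))
    (hmeas : ∀ (b f : B.Birth) (k'' k : ℕ) (U : Fld d R), AEStronglyMeasurable (fun z => Fn f k'' k (U + z)) (μ b k))
    (hdefwk : ∀ b k' k, defect b k' k ≤ wk b k' k)
    (hrate : ∀ (b : B.Birth) (k' k : ℕ), B.birthScale b ≤ k' → k' ≤ k → k ≤ B.K →
      defect b k' k ≤ cδ * ψ ^ (k - k'))
    (hlin : ∀ (b : B.Birth) (k' k : ℕ), B.birthScale b ≤ k' → k' ≤ k → k ≤ B.K →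
      RanBelow (budgetGate T s m S (4 * cδ / r) (fun i => ψ * α i)) k → ∀ ε > 0,
      ∃ U₀ ∈ 𝒦 b k' k, ∃ U₁ : Fld d R, RelGauge (rel b k' k) latMove latN U₀ U₁ (defect b k' k) ∧
        T.lin b k' k ≤ ‖Fn b k' k U₁ - Fn b k' k U₀‖ + ε) :
    T.TransportsFromVar (4 * cδ / r) (fun i => ψ * α i) (budgetGate T s m S (4 * cδ / r) (fun i => ψ * α i)) := by
  classical
  set G : ℕ → Prop := budgetGate T s m S (4 * cδ / r) (fun i => ψ * α i) with hG
  -- (a) the booked link, modulus form: the function-level budget is below the dressed budget's envelope share OUTRIGHT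
  have hs1le : ∀ b k, s1 b k ≤ m * ∑ f ∈ S k b, T.envVar (4 * cδ / r) (fun i => ψ * α i) f k := by
    intro b k
    rw [hs1 b k]
    exact budgetShare_le_mod hα hψ hcδ hr (norm_nonneg _) (hcm b k) (hSg k b) (hδf b k)
  -- (b) hence the dressed gate of scale `k` gives the function-level budget of every family alive at `k`
  have hbudget : ∀ k, k < B.K → G k → ∀ b : B.Birth, B.birthScale b ≤ k → s b k + s1 b k ≤ 1 := by
    intro k _ hg b hb
    have h := hg b hb
    linarith [hs1le b k]
  -- (c) the centred perturbation slice under the history, on the NEXT window, at the dressed budget's size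
  have hP : ∀ (b : B.Birth) (k' k : ℕ), B.birthScale b ≤ k' → k' ≤ k → k + 1 ≤ B.K → RanBelow G (k + 1) →
      PertSlice (fun U z => 𝒬 b k U z - q b k U) (μ b k) latMove latN (𝒦 b k' (k + 1)) (wk b k' (k + 1)) (ϱ b k' k)
        (m * ∑ f ∈ S k b, T.envVar (4 * cδ / r) (fun i => ψ * α i) f k) := by
    intro b k' k hbk' hk'k hK hran
    have key := pertSlice_under_history_mod_swin (Gate := G) (T := T) hα hr hsl hFn h𝒢 hD hϱ hB hE hQ
      (fun k b p hp => (hSg k b p hp).2) hs1 hAsz_birth hrs_birth hAsz_step hrs_step hrs_dec hmargin hDμ hN1 hN2 hN1x hN2cx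
      hpairx hδfwk hwkx hwk hwk_anti hdiam hθ hθwk hdom hinv hmeas hbudget b k' k hbk' hk'k hK hran
    exact key.mono (hs1le b k) le_rfl Subset.rfl
  -- (d) END-F-swin by name
  exact transportLeaf_of_centredExponent_swin hα hr hsl hFn h𝒢 hD hϱ hB hE hP hDμ hN1 hN2 hdiam hθ hθwk hwk hwk_anti hdom
    hinv hdefwk hrate hlin

end FunctionLevel

/-! ## §2 The assembled leaf under ONE schedule with a cutoff-free birth window [bookkeeping] -/

section Scheduled

variable {r w : ℝ} (W : WindowScheduleModWin r w)
variable {B : T4TermFormat.Booking} {T : Trajectory B}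
variable {R : Type*} [NormedRing R] [NormedAlgebra ℂ R] [MeasurableSpace R] {d : ℕ}

/-- **END-F′-mod-swin UNDER A `WindowScheduleModWin`** [bookkeeping]: windows `𝒦 b k′ k := bondBall d (ρw k)`, fluctuation
domains `D b k := bondBall d (σ k)`, diameters `θ b k := 2σ k`, chart radii `ϱ b k′ k := ϱc k`, margin radii `ϱ₁ b k := ϱ₁ k`,
chart ∕ slice windows `wk b k′ k := wc k`, slice radii `rs f k″ k := sliceRadius W k″ k` — the geometric ∕ radius ∕ window
binders `hD`, `hϱ`, `hrs_birth`, `hrs_step`, `hrs_dec`, `hmargin`, `hwkx`, `hN1`, `hN2`, `hN1x`, `hN2cx`, `hdiam`, `hθ`, `hθwk`,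
`hwk`, `hwk_anti` ALL DISCHARGED (row S1d's `hN2_of_schedule`/`hθwk`/`hwk`/`hwk_anti_of_schedule` through `W.toWindowScheduleWin`,
this file's parent module's `hN2cx_swin_of_schedule`/`hwkx_of_schedule`/`hmargin_mod_of_schedule`, the bond-ball one-liners
inline), given `z₁ b k ∈ D b k`.  Displayed: estimate ∕ dictionary binders only ((w4) as `e³·(1 + 4·(2σ k)/ϱc k) ≤ α k`).
With `WindowScheduleModWin.geometric` the birth window is the cutoff-free `ρ∞ + ((1+2q)σ₀ + ϱ₀)/(1−q)`.  Conclusion: VERBATIM the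
field type of `BookingLeaves.htr`. [folklore] -/
theorem transportLeaf_assembled_mod_swin_of_schedule {Fn : B.Birth → ℕ → ℕ → Fld d R → ℂ}
    {rel : B.Birth → ℕ → ℕ → Fld d R → Fld d R → Prop}
    {ref : B.Birth → ℕ → Fld d R → Fld d R} {base : B.Birth → ℕ → Fld d R → ℝ}
    {𝒜 𝒬 : B.Birth → ℕ → Fld d R → Fld d R → ℂ} {q : B.Birth → ℕ → Fld d R → ℂ}
    {μ : B.Birth → ℕ → Measure (Fld d R)} {z₀ z₁ : B.Birth → ℕ → Fld d R}
    {defect : B.Birth → ℕ → ℕ → ℝ} {cδ ψ m : ℝ} {s s1 : B.Birth → ℕ → ℝ} {α : ℕ → ℝ}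
    {Asz : B.Birth → ℕ → ℕ → ℝ} {S : ℕ → B.Birth → Finset B.Birth}
    {Sg : ℕ → B.Birth → Finset (B.Birth × ℕ)} {c : B.Birth → ℕ → ℂ} {δf : B.Birth → ℕ → B.Birth × ℕ → ℝ}
    (hα : ∀ i, 0 ≤ α i) (hr : 0 < r) (hcδ : 0 ≤ cδ) (hψ : 0 ≤ ψ)
    (hsl : ∀ (b : B.Birth) (k' : ℕ), B.birthScale b ≤ k' → k' ≤ B.K →
      RanBelow (budgetGate T s m S (4 * cδ / r) (fun i => ψ * α i)) k' →
      BirthSlice (Fn b k' k') latMove latN (bondBall d (W.ρw k') : Set (Fld d R)) (W.wc k') r (T.gen b k'))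
    (hFn : ∀ (b : B.Birth) (k' k : ℕ), B.birthScale b ≤ k' → k' ≤ k → k + 1 ≤ B.K →
      RanBelow (budgetGate T s m S (4 * cδ / r) (fun i => ψ * α i)) (k + 1) →
      ∀ U, Fn b k' (k + 1) U =
        wOp (expWeight (base b k) (𝒜 b k + 𝒬 b k)) (μ b k) (z₀ b k) U (fun z => Fn b k' k (U + z)))
    (h𝒢 : ∀ (b : B.Birth) (k' k : ℕ), B.birthScale b ≤ k' → k' ≤ k → k + 1 ≤ B.K →
      RanBelow (budgetGate T s m S (4 * cδ / r) (fun i => ψ * α i)) (k + 1) →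
      ∀ U, (fun z => Fn b k' k (U + z)) ∈ BddClass ℂ (μ b k))
    (hB : ∀ (b : B.Birth) (k' k : ℕ), B.birthScale b ≤ k' → k' ≤ k → k + 1 ≤ B.K →
      RanBelow (budgetGate T s m S (4 * cδ / r) (fun i => ψ * α i)) (k + 1) →
      RealBaseAt (ref b k) (base b k) (𝒜 b k) (μ b k) (bondBall d (W.ρw (k + 1)) : Set (Fld d R)))
    (hE : ∀ (b : B.Birth) (k' k : ℕ), B.birthScale b ≤ k' → k' ≤ k → k + 1 ≤ B.K →
      RanBelow (budgetGate T s m S (4 * cδ / r) (fun i => ψ * α i)) (k + 1) →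
      ExponentSliceAt (ref b k) (𝒜 b k) (μ b k) latMove latN (bondBall d (W.ρw (k + 1)) : Set (Fld d R)) (W.wc (k + 1))
        (W.ϱc k) (s b k))
    (hQ : ∀ b k, (fun U z => 𝒬 b k U z - q b k U) =
      fun U z => c b k * ∑ p ∈ Sg k b, (Fn p.1 p.2 k (U + z) - Fn p.1 p.2 k (U + z₁ b k)))
    (hSg : ∀ k b, ∀ p ∈ Sg k b, p.1 ∈ S k b ∧ B.birthScale p.1 ≤ p.2 ∧ p.2 ≤ k)
    (hs1 : ∀ b k, s1 b k = ‖c b k‖ * ∑ p ∈ Sg k b, (4 / r * stepProd α p.2 k * T.gen p.1 p.2) * δf b k p)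
    (hAsz_birth : ∀ f k'', Asz f k'' k'' = T.gen f k'')
    (hAsz_step : ∀ f k'' k, B.birthScale f ≤ k'' → k'' ≤ k →
      Asz f k'' (k + 1) = Real.exp (3 * (s f k + s1 f k)) * Asz f k'' k)
    (hcm : ∀ b k, ‖c b k‖ ≤ m)
    (hδf : ∀ b k, ∀ p ∈ Sg k b, 0 ≤ δf b k p ∧ δf b k p ≤ cδ * ψ ^ (k - p.2))
    (hδfwk : ∀ b k, ∀ p ∈ Sg k b, δf b k p ≤ W.wc k)
    (hDμ : ∀ b k, ∀ᵐ z ∂μ b k, z ∈ (bondBall d (W.σ k) : Set (Fld d R)))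
    (hz₁ : ∀ b k, z₁ b k ∈ (bondBall d (W.σ k) : Set (Fld d R)))
    (hpairx : ∀ (b : B.Birth) (k' k : ℕ), B.birthScale b ≤ k' → k' ≤ k →
      ∀ p ∈ Sg k b, ∀ U₀ ∈ (bondBall d (W.ρw (k + 1)) : Set (Fld d R)), ∀ pd : NDir d R, 0 < latN pd →
        latN pd ≤ W.wc (k + 1) →
        ∀ᵐ z ∂μ b k, ∀ t ∈ tube (W.ϱ₁ k / latN pd),
          RelGauge (rel p.1 p.2 k) latMove latN (latMove U₀ pd t + z₁ b k) (latMove U₀ pd t + z) (δf b k p))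
    (hdom : ∀ k, k + 1 ≤ B.K → Real.exp 3 * (1 + 4 * (2 * W.σ k) / W.ϱc k) ≤ α k)
    (hinv : ∀ b k' k, GaugeInvariant (rel b k' k) (Fn b k' k))
    (hmeas : ∀ (b f : B.Birth) (k'' k : ℕ) (U : Fld d R), AEStronglyMeasurable (fun z => Fn f k'' k (U + z)) (μ b k))
    (hdefwk : ∀ (_b : B.Birth) (_k' k : ℕ), defect _b _k' k ≤ W.wc k)
    (hrate : ∀ (b : B.Birth) (k' k : ℕ), B.birthScale b ≤ k' → k' ≤ k → k ≤ B.K →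
      defect b k' k ≤ cδ * ψ ^ (k - k'))
    (hlin : ∀ (b : B.Birth) (k' k : ℕ), B.birthScale b ≤ k' → k' ≤ k → k ≤ B.K →
      RanBelow (budgetGate T s m S (4 * cδ / r) (fun i => ψ * α i)) k → ∀ ε > 0,
      ∃ U₀ ∈ (bondBall d (W.ρw k) : Set (Fld d R)), ∃ U₁ : Fld d R,
        RelGauge (rel b k' k) latMove latN U₀ U₁ (defect b k' k) ∧
        T.lin b k' k ≤ ‖Fn b k' k U₁ - Fn b k' k U₀‖ + ε) :
    T.TransportsFromVar (4 * cδ / r) (fun i => ψ * α i) (budgetGate T s m S (4 * cδ / r) (fun i => ψ * α i)) :=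
  transportLeaf_assembled_mod_swin (𝒦 := fun _ _ k => (bondBall d (W.ρw k) : Set (Fld d R)))
    (D := fun _ k => (bondBall d (W.σ k) : Set (Fld d R))) (θ := fun _ k => 2 * W.σ k) (ϱ := fun _ _ k => W.ϱc k)
    (ϱ₁ := fun _ k => W.ϱ₁ k) (wk := fun _ _ k => W.wc k) (rs := fun _ k'' k => W.sliceRadius k'' k)
    hα hr hcδ hψ hsl hFn h𝒢 (fun _ k => ⟨0, fun x ν => by simpa using (W.hσ k).le⟩) (fun _ _ k => W.hϱc k) hB hE hQ hSg
    hs1 hAsz_birth (fun _ k'' => W.sliceRadius_birth k'') hAsz_step (fun _ _ _ _ h => W.sliceRadius_step h)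
    (fun _ k'' k _ _ => W.ϱc_lt_sliceRadius k'' k) (hmargin_mod_of_schedule W Sg) hcm hδf (fun b k p hp => hδfwk b k p hp)
    (hwkx_of_schedule W Sg) hDμ
    (fun _ _ k _ _ _ => bondBall_add_mem (by linarith [W.σ_add_wc_le_gap k, W.wc_pos (k + 1)]))
    (hN2_of_schedule W.toWindowScheduleWin)
    (fun _ _ k _ _ _ _ => bondBall_add_mem (by linarith [W.σ_add_wc_le_gap k, W.wc_pos (k + 1)]))
    (hN2cx_swin_of_schedule W Sg hz₁) hpairx (fun _ _ => bondBall_diam)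
    (fun _ k => ⟨by linarith [W.hσ k], (W.hσwc k).trans (W.hwcw k)⟩) (hθwk_of_schedule W.toWindowScheduleWin)
    (hwk_of_schedule W.toWindowScheduleWin) (hwk_anti_of_schedule W.toWindowScheduleWin) (fun _ _ k _ _ hk => hdom k hk) hinv
    hmeas hdefwk hrate hlin

end Scheduled

end Summit.QuantumFields.BalabanUV.T4Continuum.NE1p.DressedTransportAssembledModSliceWin

end
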